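import Summits.QuantumFields.YangMills.Theorems.F4SubCurvatureDoorConeFatouEndgame
import Mathlib
import HarnessLib

/-!
# Route `F4SubCurvatureDoor`, crux ⟨stmt-QuantumFields-23125⟩ `RationalToGeneral`: LINE g18-A v5 «top-channel cone cut»
# (planner `ym-idea-3` g18, tree skeleton `Cruxes/RationalToGeneral/Lines/sextic_channel.lean` commit 9dfcf5fb94f6) —
# registered stub `stub_coneFatouEndgame : ConeFatouEndgame` BY NAME AND SIGNATURE

The name-keyed statement of the skeleton (`E3`, `ConeFatouEndgame`) copied VERBATIM into this file's own namespace (pattern of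
`F4SubCurvatureDoorMirrorAnalyticityRegistered`), and the registered stub `theorem stub_coneFatouEndgame : ConeFatouEndgame` proved
by the spelled-out tree theorem `F4SubCurvatureDoorConeFatouEndgame.coneFatouEndgame` (the two statements agree definitionally:
`E3` is an abbreviation of `EuclideanSpace ℝ (Fin 3)`), so the skeleton's stub closes by
`exact Summit.QuantumFields.YangMills.Theorems.F4SubCurvatureDoorConeFatouEndgame.coneFatouEndgame`.

Mathlib + tree only; no `sorry`; standard axioms.  HONEST FRAMING: support stub `ConeFatouEndgame` of an OPEN line; the wall T1″
(`AnalyticFiniteType`), `ChannelShellForm`, C3, crux 23125 / 23035, rung R2d (`BalabanLadder.ROT`) and the summit are untouched;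
the Yang–Mills mass gap is NOT proved.  Fleet seat `ym-spine-19353-p1` g24 (free capacity; owner ACK 2026-08-29T03:26:58Z). [folklore]
-/

set_option autoImplicit false

noncomputable section

namespace Summit.QuantumFields.YangMills.Theorems.F4SubCurvatureDoorConeFatouEndgameRegistered

open scoped Topology BigOperators
open Filter Set MeasureTheory

/-- Euclidean `ℝ³` (verbatim from the skeleton). -/
abbrev E3 := EuclideanSpace ℝ (Fin 3)

/-- Stub «CONE–FATOU ENDGAME» (verbatim from the skeleton): a finite family of signed measures `ρ⁺_a − ρ⁻_a` on `[0,∞)` whose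
increments on bounded sets lie in the POINTED closed convex cone `{v : Σ_a v_a N_a(q⃗) ≥ 0 ∀ q⃗}` and whose `φ`-transforms all
tend to `0` as `r → 0⁺` (`φ ≥ 0` measurable, continuous at `0` from the right, `φ(0) > 0`) is ZERO. -/
abbrev ConeFatouEndgame : Prop :=
  ∀ (φ : ℝ → ℝ), Measurable φ → (∀ u, 0 ≤ φ u) → ContinuousWithinAt φ (Set.Ici 0) 0 → 0 < φ 0 →
  ∀ (A : Type) [Fintype A] (N : A → E3 → ℝ) (ρp ρm : A → Measure ℝ),
    (∀ a, IsLocallyFiniteMeasure (ρp a) ∧ IsLocallyFiniteMeasure (ρm a)) →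
    (∀ a, (ρp a) (Set.Iio 0) = 0 ∧ (ρm a) (Set.Iio 0) = 0) →
    (∀ v : A → ℝ, (∀ q : E3, ∑ a, v a * N a q = 0) → v = 0) →
    (∀ S : Set ℝ, MeasurableSet S → Bornology.IsBounded S →
        ∀ q : E3, 0 ≤ ∑ a, (((ρp a) S).toReal - ((ρm a) S).toReal) * N a q) →
    (∀ a (r : ℝ), 0 < r → Integrable (fun M => φ (M * r)) (ρp a) ∧ Integrable (fun M => φ (M * r)) (ρm a)) →
    (∀ a, Tendsto (fun r : ℝ => (∫ M, φ (M * r) ∂(ρp a)) - ∫ M, φ (M * r) ∂(ρm a)) (𝓝[>] 0) (𝓝 0)) →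
    ∀ a, ρp a = ρm a

/-- **Registered stub `stub_coneFatouEndgame` of LINE g18-A v5, BY NAME AND SIGNATURE**: `ConeFatouEndgame` holds — it is the
spelled-out tree theorem `F4SubCurvatureDoorConeFatouEndgame.coneFatouEndgame` (per-`q⃗` positive pair of measures, tail
comparison, dominated convergence on `[0, n]`, pointedness). [folklore] -/
theorem stub_coneFatouEndgame : ConeFatouEndgame :=
  Summit.QuantumFields.YangMills.Theorems.F4SubCurvatureDoorConeFatouEndgame.coneFatouEndgame

end Summit.QuantumFields.YangMills.Theorems.F4SubCurvatureDoorConeFatouEndgameRegistered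

end
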